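import Mathlib
import HarnessLib

/-!
# `NoHeavyLowerTail` (crux stmt-CriticalPhenomena-4575), antithetic vdBHK programme: the PAIR-INSERTION LEMMA (two worlds and four ports)

Support file (seat `prim-ineq-gen-7` gen 24; `--supports stmt-CriticalPhenomena-4575`).  Nothing is asserted about the crux; no `sorry`,
no definitions (the AK summand `1_A(u)(1_B(u) − 1_B(ι u))` is written out, as in T7 `AntitheticGluing.polarGluing`).
Memo: run/shared/lean/prim/prim-ineq-gen-7/FINDING-SUNS-g24.md §1 (LEMMA B with r = 1; = g23's structural proof of THEOREM D made abstract).

SETTING.  A preorder `P` with an involution `ι`; finite sets `S₁, S₂` ('worlds') and four further elements `p ≤ q`, `p' ≤ q'` ('ports':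
in the twisted double `X(P₀,D)` along a down-set with `D ∩ ιD ∋ z`, these are `p = (z,R) < q = (z,B)`, `p' = (ιz,R) < q' = (ιz,B)`, and
`S₁, S₂` are the two copies of `P₀ ∖ {z, ιz}`), with `ι p = q'`, `ι q = p'`.  AK of a finite set `Q` (counting form):
`Σ_{u∈Q} 1_A(u)(1_B(u) − 1_B(ι u)) ≥ 0` for all up-sets `A, B`.

THEOREM (`pair_insertion`).  Suppose `S₁`, `S₂` are AK and the four EMBEDDING CERTIFICATES hold:
  E1 : `q ∈ A, p' ∉ A, q' ∈ B, p ∉ B ⇒ Σ_{S₁} ≥ 1`,    E1': `p ∉ A, q' ∈ A, q ∈ B, p' ∉ B ⇒ Σ_{S₁} ≥ 1`,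
  E2 : `p ∈ A, q' ∉ A, p' ∈ B, q ∉ B ⇒ Σ_{S₂} ≥ 1`,    E2': `p' ∈ A, q ∉ A, p ∈ B, q' ∉ B ⇒ Σ_{S₂} ≥ 1`.
Then `S₁ ∪ S₂ ∪ {p, q, p', q'}` is AK.
In the application the certificates come from AK of `P₀` (resp. `P₀` minus other pairs): under the premises of E1 the traces
`A ∩ S₁ ∪ {z}`, `B ∩ S₁ ∪ {ιz}` are up-sets of `P₀` on which the AK form equals `Σ_{S₁} − 1` (memo §1 (F3)–(F4)).  The proof here is the
finite port table (memo (F5), r = 1; machine table portcases.py CHECK 1): the four ports contribute `t ≥ −2` to the AK sum, and whenever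
`t < 0` the premises of `|t|` distinct certificates hold.
-/

namespace Summit.CriticalPhenomena.PercolationContinuityZ3.Theorems

open Finset

namespace AntitheticPort

variable {P : Type*} [Preorder P] [DecidableEq P]

omit [Preorder P] [DecidableEq P] in
/-- The finite PORT TABLE (memo §1 (F5) for r = 1; machine twin: portcases.py CHECK 1): for 0/1 port indicators respecting `p ≤ q`,
`p' ≤ q'`, world sums bounded below by the certificate products, the four ports never cost more than the certificates pay. [this work] -/
theorem port_table (s₁ s₂ xp xq xp' xq' yp yq yp' yq' : ℤ)
    (c1 : xp = 0 ∨ xp = 1) (c2 : xq = 0 ∨ xq = 1) (c3 : xp' = 0 ∨ xp' = 1) (c4 : xq' = 0 ∨ xq' = 1)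
    (c5 : yp = 0 ∨ yp = 1) (c6 : yq = 0 ∨ yq = 1) (c7 : yp' = 0 ∨ yp' = 1) (c8 : yq' = 0 ∨ yq' = 1)
    (m1 : xp ≤ xq) (m2 : xp' ≤ xq') (m3 : yp ≤ yq) (m4 : yp' ≤ yq') (h1 : 0 ≤ s₁) (h2 : 0 ≤ s₂)
    (e1 : xq * (1 - xp') * yq' * (1 - yp) ≤ s₁) (e1' : (1 - xp) * xq' * yq * (1 - yp') ≤ s₁)
    (e2 : xp * (1 - xq') * yp' * (1 - yq) ≤ s₂) (e2' : xp' * (1 - xq) * yp * (1 - yq') ≤ s₂) :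
    0 ≤ s₁ + s₂ + (xp * (yp - yq') + xq * (yq - yp') + xp' * (yp' - yq) + xq' * (yq' - yp)) := by
  rcases c1 with rfl | rfl <;> rcases c2 with rfl | rfl <;> rcases c3 with rfl | rfl <;> rcases c4 with rfl | rfl <;>
    rcases c5 with rfl | rfl <;> rcases c6 with rfl | rfl <;> rcases c7 with rfl | rfl <;> rcases c8 with rfl | rfl <;>
    linarith

/-- **Pair-insertion lemma (LEMMA B of the memo, r = 1, ambient form).**  Two AK worlds `S₁, S₂` plus the four ports `p ≤ q`, `p' ≤ q'`
(`ι p = q'`, `ι q = p'`) form an AK set as soon as the four embedding certificates E1, E1', E2, E2' hold. [this work; memo §1] -/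
theorem pair_insertion (ι : P → P) (S₁ S₂ : Finset P) (p q p' q' : P)
    (hpq : p ≤ q) (hp'q' : p' ≤ q') (hιp : ι p = q') (hιq : ι q = p') (hιp' : ι p' = q) (hιq' : ι q' = p)
    (hdisj : Disjoint S₁ S₂)
    (hpS : p ∉ S₁ ∪ S₂) (hqS : q ∉ S₁ ∪ S₂) (hp'S : p' ∉ S₁ ∪ S₂) (hq'S : q' ∉ S₁ ∪ S₂)
    (hpq_ne : p ≠ q) (hpp' : p ≠ p') (hpq' : p ≠ q') (hqp' : q ≠ p') (hqq' : q ≠ q') (hp'q'_ne : p' ≠ q')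
    (h₁ : ∀ A B : Finset P, (∀ u v, u ≤ v → u ∈ A → v ∈ A) → (∀ u v, u ≤ v → u ∈ B → v ∈ B) →
      0 ≤ ∑ u ∈ S₁, ((if u ∈ A then (1:ℤ) else 0) * ((if u ∈ B then (1:ℤ) else 0) - (if ι u ∈ B then (1:ℤ) else 0))))
    (h₂ : ∀ A B : Finset P, (∀ u v, u ≤ v → u ∈ A → v ∈ A) → (∀ u v, u ≤ v → u ∈ B → v ∈ B) →
      0 ≤ ∑ u ∈ S₂, ((if u ∈ A then (1:ℤ) else 0) * ((if u ∈ B then (1:ℤ) else 0) - (if ι u ∈ B then (1:ℤ) else 0))))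
    (E1 : ∀ A B : Finset P, (∀ u v, u ≤ v → u ∈ A → v ∈ A) → (∀ u v, u ≤ v → u ∈ B → v ∈ B) →
      q ∈ A → p' ∉ A → q' ∈ B → p ∉ B →
      1 ≤ ∑ u ∈ S₁, ((if u ∈ A then (1:ℤ) else 0) * ((if u ∈ B then (1:ℤ) else 0) - (if ι u ∈ B then (1:ℤ) else 0))))
    (E1' : ∀ A B : Finset P, (∀ u v, u ≤ v → u ∈ A → v ∈ A) → (∀ u v, u ≤ v → u ∈ B → v ∈ B) →
      p ∉ A → q' ∈ A → q ∈ B → p' ∉ B →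
      1 ≤ ∑ u ∈ S₁, ((if u ∈ A then (1:ℤ) else 0) * ((if u ∈ B then (1:ℤ) else 0) - (if ι u ∈ B then (1:ℤ) else 0))))
    (E2 : ∀ A B : Finset P, (∀ u v, u ≤ v → u ∈ A → v ∈ A) → (∀ u v, u ≤ v → u ∈ B → v ∈ B) →
      p ∈ A → q' ∉ A → p' ∈ B → q ∉ B →
      1 ≤ ∑ u ∈ S₂, ((if u ∈ A then (1:ℤ) else 0) * ((if u ∈ B then (1:ℤ) else 0) - (if ι u ∈ B then (1:ℤ) else 0))))
    (E2' : ∀ A B : Finset P, (∀ u v, u ≤ v → u ∈ A → v ∈ A) → (∀ u v, u ≤ v → u ∈ B → v ∈ B) →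
      p' ∈ A → q ∉ A → p ∈ B → q' ∉ B →
      1 ≤ ∑ u ∈ S₂, ((if u ∈ A then (1:ℤ) else 0) * ((if u ∈ B then (1:ℤ) else 0) - (if ι u ∈ B then (1:ℤ) else 0))))
    (A B : Finset P) (hA : ∀ u v, u ≤ v → u ∈ A → v ∈ A) (hB : ∀ u v, u ≤ v → u ∈ B → v ∈ B) :
    0 ≤ ∑ u ∈ S₁ ∪ S₂ ∪ {p, q, p', q'}, ((if u ∈ A then (1:ℤ) else 0) * ((if u ∈ B then (1:ℤ) else 0) - (if ι u ∈ B then (1:ℤ) else 0))) := by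
  -- split the sum: worlds + the four ports
  have hdisj' : Disjoint (S₁ ∪ S₂) ({p, q, p', q'} : Finset P) := by
    rw [Finset.disjoint_left]
    intro u hu hu'
    simp only [Finset.mem_insert, Finset.mem_singleton] at hu'
    rcases hu' with rfl | rfl | rfl | rfl
    · exact hpS hu
    · exact hqS hu
    · exact hp'S hu
    · exact hq'S hu
  rw [Finset.sum_union hdisj', Finset.sum_union hdisj]
  have hport : ∑ u ∈ ({p, q, p', q'} : Finset P), ((if u ∈ A then (1:ℤ) else 0) * ((if u ∈ B then (1:ℤ) else 0) - (if ι u ∈ B then (1:ℤ) else 0)))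
      = (if p ∈ A then (1:ℤ) else 0) * ((if p ∈ B then (1:ℤ) else 0) - (if q' ∈ B then (1:ℤ) else 0))
        + (if q ∈ A then (1:ℤ) else 0) * ((if q ∈ B then (1:ℤ) else 0) - (if p' ∈ B then (1:ℤ) else 0))
        + (if p' ∈ A then (1:ℤ) else 0) * ((if p' ∈ B then (1:ℤ) else 0) - (if q ∈ B then (1:ℤ) else 0))
        + (if q' ∈ A then (1:ℤ) else 0) * ((if q' ∈ B then (1:ℤ) else 0) - (if p ∈ B then (1:ℤ) else 0)) := by
    rw [Finset.sum_insert (by simp [hpq_ne, hpp', hpq']), Finset.sum_insert (by simp [hqp', hqq']),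
      Finset.sum_insert (by simp [hp'q'_ne]), Finset.sum_singleton, hιp, hιq, hιp', hιq']
    ring
  rw [hport]
  -- names for the two world sums
  set s₁ := ∑ u ∈ S₁, ((if u ∈ A then (1:ℤ) else 0) * ((if u ∈ B then (1:ℤ) else 0) - (if ι u ∈ B then (1:ℤ) else 0))) with hs₁
  set s₂ := ∑ u ∈ S₂, ((if u ∈ A then (1:ℤ) else 0) * ((if u ∈ B then (1:ℤ) else 0) - (if ι u ∈ B then (1:ℤ) else 0))) with hs₂
  have hs₁0 : 0 ≤ s₁ := h₁ A B hA hB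
  have hs₂0 : 0 ≤ s₂ := h₂ A B hA hB
  -- the four certificates as numeric facts
  have e1 : (if q ∈ A then (1:ℤ) else 0) * (1 - (if p' ∈ A then (1:ℤ) else 0)) * (if q' ∈ B then (1:ℤ) else 0) * (1 - (if p ∈ B then (1:ℤ) else 0)) ≤ s₁ := by
    by_cases h1 : q ∈ A <;> by_cases h2 : p' ∈ A <;> by_cases h3 : q' ∈ B <;> by_cases h4 : p ∈ B <;>
      simp only [h1, h2, h3, h4, if_true, if_false] <;> norm_num <;>
      first | linarith | exact E1 A B hA hB h1 h2 h3 h4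
  have e1' : (1 - (if p ∈ A then (1:ℤ) else 0)) * (if q' ∈ A then (1:ℤ) else 0) * (if q ∈ B then (1:ℤ) else 0) * (1 - (if p' ∈ B then (1:ℤ) else 0)) ≤ s₁ := by
    by_cases h1 : p ∈ A <;> by_cases h2 : q' ∈ A <;> by_cases h3 : q ∈ B <;> by_cases h4 : p' ∈ B <;>
      simp only [h1, h2, h3, h4, if_true, if_false] <;> norm_num <;>
      first | linarith | exact E1' A B hA hB h1 h2 h3 h4
  have e2 : (if p ∈ A then (1:ℤ) else 0) * (1 - (if q' ∈ A then (1:ℤ) else 0)) * (if p' ∈ B then (1:ℤ) else 0) * (1 - (if q ∈ B then (1:ℤ) else 0)) ≤ s₂ := by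
    by_cases h1 : p ∈ A <;> by_cases h2 : q' ∈ A <;> by_cases h3 : p' ∈ B <;> by_cases h4 : q ∈ B <;>
      simp only [h1, h2, h3, h4, if_true, if_false] <;> norm_num <;>
      first | linarith | exact E2 A B hA hB h1 h2 h3 h4
  have e2' : (if p' ∈ A then (1:ℤ) else 0) * (1 - (if q ∈ A then (1:ℤ) else 0)) * (if p ∈ B then (1:ℤ) else 0) * (1 - (if q' ∈ B then (1:ℤ) else 0)) ≤ s₂ := by
    by_cases h1 : p' ∈ A <;> by_cases h2 : q ∈ A <;> by_cases h3 : p ∈ B <;> by_cases h4 : q' ∈ B <;>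
      simp only [h1, h2, h3, h4, if_true, if_false] <;> norm_num <;>
      first | linarith | exact E2' A B hA hB h1 h2 h3 h4
  -- 0/1-valuedness and monotonicity of the eight port indicators
  have h01 : ∀ (c : Prop) [Decidable c], ((if c then (1:ℤ) else 0) = 0 ∨ (if c then (1:ℤ) else 0) = 1) := by
    intro c _; by_cases hc : c <;> simp [hc]
  have hmono : ∀ (c d : Prop) [Decidable c] [Decidable d], (c → d) → (if c then (1:ℤ) else 0) ≤ (if d then (1:ℤ) else 0) := by
    intro c d _ _ hcd; by_cases hc : c <;> by_cases hd : d <;> simp [hc, hd]; exact hd (hcd hc)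
  -- the finite port table
  exact port_table s₁ s₂ _ _ _ _ _ _ _ _ (h01 (p ∈ A)) (h01 (q ∈ A)) (h01 (p' ∈ A)) (h01 (q' ∈ A)) (h01 (p ∈ B)) (h01 (q ∈ B)) (h01 (p' ∈ B)) (h01 (q' ∈ B))
    (hmono _ _ (hA p q hpq)) (hmono _ _ (hA p' q' hp'q')) (hmono _ _ (hB p q hpq)) (hmono _ _ (hB p' q' hp'q'))
    hs₁0 hs₂0 e1 e1' e2 e2'

end AntitheticPort

end Summit.CriticalPhenomena.PercolationContinuityZ3.Theorems
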